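import Summits.CriticalPhenomena.PercolationContinuityZ3.Theorems.PercShatteringRaceNearLinearTwoClusterDecaySplit
import Summits.CriticalPhenomena.PercolationContinuityZ3.Theorems.PercShatteringRaceNearLinearTwoClusterDecayConsumedBoxLRO
import HarnessLib

/-!
# RestateCheck-c7 — crux `NearLinearTwoClusterDecay` (stmt-CriticalPhenomena-5785): the two planner actions, rendered and checked

Scratch certificate of lead c7 (2026-08-17) for the TENURE PLANNER of route `PercShatteringRace`
(companion of `RESTATE-5785-c7.md` in this crux directory).  It renders, with the route file's own
`open` lines and fully-qualified names (so every `def` body below can be pasted verbatim as a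
`--statement` / `children.json` entry), the two structural options that every seat since c3 has
recommended and no planner has yet filed, and checks on the farm that each typechecks BY NAME against
the landed Theorems:

* **Option A — SPLIT** `U ⇐ PairTwoArmsDecay ∧ LongArmsAreDense` (strategist's `children.json`):
  the children `PairTwoArmsDecay`, `LongArmsAreDense` below are the two hypotheses of the landed glue
  `Theorems.nearLinearTwoClusterDecay_of_subs` (p137625) verbatim
  (`splitGlue_typechecks`); the re-threaded deciding theorem through child 1 alone is `closesA`
  (`percolationContinuityZ3_of_powerSaving_of_pairTwoArmsDecay`, p137625); child 1 is necessary for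
  the crux (`childOne_of_crux`).
* **Option B — RESTATE** stmt-5785 to the consumed form `JumpBoxLRO` (jump-world in-box LRO at aspect
  `n^{7/6}`, centre-rooted) and stmt-5788 `RaceLemma` to `RaceLemmaLRO` (proved 1:1 by the landed
  `Consumed.raceLemma_of_jumpBoxLRO`, p125450: `raceLemmaLRO_proof`); the new deciding theorem is
  `closesB` (same three-hypothesis shape as today's `closes`); the restated crux is a WEAKENING of the
  filed one (`jumpBoxLRO_of_crux`, via `Consumed.jumpBoxLRO_of_jumpTwoClusterDecay`), so nothing the
  route had is lost.

No new mathematics; nothing here is proposed to the gate (a prover may not file route edits).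
-/

namespace Summit.CriticalPhenomena.PercolationContinuityZ3.Cruxes.NearLinearTwoClusterDecay.RestateCheckC7

-- every `Summit.CriticalPhenomena.PercolationContinuityZ3.…` name repeats the summit segment (D-0017 layout)
set_option linter.dupNamespace false

-- EXACTLY the route file's opens (Theses/PercShatteringRace.lean), nothing more:
open scoped BigOperators Topology Manifold Classical MeasureTheory ProbabilityTheory Matrix InnerProductSpace ComplexConjugate ContinuousMap
open Filter Set Function TopologicalSpace MeasureTheory

open Summit.CriticalPhenomena.PercolationContinuityZ3.Theses.PercShatteringRace (NearLinearTwoClusterDecay FreeSusceptibilityPowerSaving)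

/-! ## Option A — SPLIT (children of stmt-5785; glue already landed) -/

/-- Child 1 `PairTwoArmsDecay` (kind crux): the PAIR form of `U(1/6)` — for every `ε > 0`, eventually in `n`, for all
deterministic `x, x' ∈ Λ(n)`, the probability that both reach `∂ⁱⁿΛ(m)` inside `Λ(m)`, `m = ⌈n^{7/6}⌉`, without being
joined inside `Λ(m)` is `≤ ε`.  Text = hypothesis `h₁` of `nearLinearTwoClusterDecay_of_subs`, fully qualified. -/
def PairTwoArmsDecay : Prop :=
  ∀ ε : ℝ, 0 < ε → ∀ᶠ n : ℕ in Filter.atTop, ∀ x ∈ Literature.Probability.LatticeModels.box 3 n, ∀ x' ∈ Literature.Probability.LatticeModels.box 3 n, (Literature.Probability.Percolation.bondPercolation (Literature.Probability.LatticeModels.zdGraph 3) (Literature.Probability.Percolation.criticalProbI 3)).real {ω | ∃ y ∈ Literature.Probability.LatticeModels.innerBoundary (Literature.Probability.LatticeModels.zdGraph 3) (Literature.Probability.LatticeModels.box 3 ⌈(n : ℝ) ^ ((7 : ℝ) / 6)⌉₊), ∃ y' ∈ Literature.Probability.LatticeModels.innerBoundary (Literature.Probability.LatticeModels.zdGraph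 3) (Literature.Probability.LatticeModels.box 3 ⌈(n : ℝ) ^ ((7 : ℝ) / 6)⌉₊), ω ∈ Literature.Probability.Percolation.openConnIn ↑(Literature.Probability.LatticeModels.box 3 ⌈(n : ℝ) ^ ((7 : ℝ) / 6)⌉₊) x y ∧ ω ∈ Literature.Probability.Percolation.openConnIn ↑(Literature.Probability.LatticeModels.box 3 ⌈(n : ℝ) ^ ((7 : ℝ) / 6)⌉₊) x' y' ∧ ω ∉ Literature.Probability.Percolation.openConnIn ↑(Literature.Probability.LatticeModels.box 3 ⌈(n : ℝ) ^ ((7 : ℝ) / 6)⌉₊) x x'} ≤ ε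

/-- Child 2 `LongArmsAreDense` (kind crux): every in-box arm from `Λ(n)` to `∂ⁱⁿΛ(⌈n^{7/6}⌉)` is carried by a cluster whose
`Λ(n)`-trace has at least `κ|Λ(n)|` sites, w.h.p.  Text = hypothesis `h₂` of `nearLinearTwoClusterDecay_of_subs`, fully qualified. -/
def LongArmsAreDense : Prop :=
  ∀ ε : ℝ, 0 < ε → ∃ κ : ℝ, 0 < κ ∧ ∀ᶠ n : ℕ in Filter.atTop, (Literature.Probability.Percolation.bondPercolation (Literature.Probability.LatticeModels.zdGraph 3) (Literature.Probability.Percolation.criticalProbI 3)).real {ω | ∃ x ∈ Literature.Probability.LatticeModels.box 3 n, (∃ y ∈ Literature.Probability.LatticeModels.innerBoundary (Literature.Probability.LatticeModels.zdGraph 3) (Literature.Probability.LatticeModels.box 3 ⌈(n : ℝ) ^ ((7 : ℝ) / 6)⌉₊), ω ∈ Literature.Probability.Percolation.openConnIn ↑(Literature.Probability.LatticeModels.box 3 ⌈(n : ℝ) ^ ((7 : ℝ) / 6)⌉₊) x y) ∧ (Set.ncard {z : Literature.Probability.LatticeModels.Site 3 | z ∈ Literature.Probability.LatticeModels.box 3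 n ∧ ω ∈ Literature.Probability.Percolation.openConnIn ↑(Literature.Probability.LatticeModels.box 3 ⌈(n : ℝ) ^ ((7 : ℝ) / 6)⌉₊) x z} : ℝ) < κ * (Literature.Probability.LatticeModels.box 3 n).card} ≤ ε

/-- `--glue-by` check: the landed glue has LITERALLY the type `Child₁ → Child₂ → NearLinearTwoClusterDecay`. [folklore] -/
theorem splitGlue_typechecks : PairTwoArmsDecay → LongArmsAreDense → NearLinearTwoClusterDecay :=
  Summit.CriticalPhenomena.PercolationContinuityZ3.Theorems.nearLinearTwoClusterDecay_of_subs

/-- The RE-THREADED deciding theorem after the split (for `--closes-file`): the other crux `S(1/2)` and child 1 alone give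
the sub-problem statement; child 2 and `U` itself are then not load-bearing for the route. [folklore] -/
theorem closesA (hS : FreeSusceptibilityPowerSaving) (hP : PairTwoArmsDecay) : PercolationContinuityZ3 :=
  Summit.CriticalPhenomena.PercolationContinuityZ3.Theorems.percolationContinuityZ3_of_powerSaving_of_pairTwoArmsDecay
    hS hP

/-- Child 1 is NECESSARY for the filed crux (so the split loses nothing on that side). [folklore] -/
theorem childOne_of_crux (hU : NearLinearTwoClusterDecay) : PairTwoArmsDecay :=
  Summit.CriticalPhenomena.PercolationContinuityZ3.Theorems.pairTwoArmsDecay_of_nearLinearTwoClusterDecay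
    hU

/-- Option A's new SUPPORT item `RaceLemmaPair` (needed because a Theses file cannot import Theorems: the re-threaded
`closes` must take the race as an ITEM hypothesis, exactly as today's `closes` takes `RaceLemma`): `S(1/2)` and child 1 give
`θ(p_c) = 0`.  PROVED 1:1 by the landed `Theorems.percolationContinuityZ3_of_powerSaving_of_pairTwoArmsDecay` (p137625). -/
def RaceLemmaPair : Prop :=
  (∃ C : ℝ, ∀ R : ℕ, 1 ≤ R → ∑ y ∈ Literature.Probability.LatticeModels.box 3 R, (Literature.Probability.Percolation.bondPercolation (Literature.Probability.LatticeModels.zdGraph 3) (Literature.Probability.Percolation.criticalProbI 3)).real (Literature.Probability.Percolation.openConnIn ↑(Literature.Probability.LatticeModels.box 3 R) 0 y) ≤ C * (R : ℝ) ^ ((5 : ℝ) / 2)) → (∀ ε : ℝ, 0 < ε → ∀ᶠ n : ℕ in Filter.atTop, ∀ x ∈ Literature.Probability.LatticeModels.box 3 n, ∀ x' ∈ Literature.Probability.LatticeModels.box 3 n, (Literature.Probability.Percolation.bondPercolation (Literature.Probability.LatticeModels.zdGraph 3) (Literature.Probability.Percolation.criticalProbI 3)).real {ω | ∃ y ∈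 Literature.Probability.LatticeModels.innerBoundary (Literature.Probability.LatticeModels.zdGraph 3) (Literature.Probability.LatticeModels.box 3 ⌈(n : ℝ) ^ ((7 : ℝ) / 6)⌉₊), ∃ y' ∈ Literature.Probability.LatticeModels.innerBoundary (Literature.Probability.LatticeModels.zdGraph 3) (Literature.Probability.LatticeModels.box 3 ⌈(n : ℝ) ^ ((7 : ℝ) / 6)⌉₊), ω ∈ Literature.Probability.Percolation.openConnIn ↑(Literature.Probability.LatticeModels.box 3 ⌈(n : ℝ) ^ ((7 : ℝ) / 6)⌉₊) x y ∧ ω ∈ Literature.Probability.Percolation.openConnIn ↑(Literature.Probability.LatticeModels.box 3 ⌈(n : ℝ) ^ ((7 : ℝ) / 6)⌉₊) x' y' ∧ ω ∉ Literature.Probability.Percolation.openConnIn ↑(Literature.Probability.LatticeModels.box 3 ⌈(n : ℝ) ^ ((7 : ℝ) / 6)⌉₊) x x'} ≤ ε) → PercolationContinuityZ3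

/-- The new support is closed BY NAME by the landed theorem. [folklore] -/
theorem raceLemmaPair_proof : RaceLemmaPair :=
  Summit.CriticalPhenomena.PercolationContinuityZ3.Theorems.percolationContinuityZ3_of_powerSaving_of_pairTwoArmsDecay

/-- Option A's deciding theorem as it would stand IN THE ROUTE FILE (items only as hypotheses; for `--closes-file`). [folklore] -/
theorem closesA' (hS : FreeSusceptibilityPowerSaving) (hP : PairTwoArmsDecay) (hRP : RaceLemmaPair) :
    PercolationContinuityZ3 :=
  hRP hS hP

/-! ## Option B — RESTATE stmt-5785 to the consumed form (and stmt-5788 to match) -/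

/-- Restated crux `JumpBoxLRO` (the LITERAL consumed form of `U(1/6)`, centre-rooted, jump-world-guarded): if `θ(p_c) > 0`
then there is `c > 0` such that eventually in `n`, for every `y ∈ Λ(n)`, `P_{p_c}(0 ↔ y inside Λ(⌈n^{7/6}⌉)) ≥ c`.  In words:
in a jump world the infinite cluster has in-box long-range order at polynomial aspect `7/6` (Cerf 2015 Thm 1.3 gives aspect 16,
site; bond aspect 16 is stmt-0860, closed).  Vacuous iff `θ(p_c) = 0` — i.e. it carries NO `θ(p_c)=0`-world (hyperscaling)
content, unlike `U`. -/
def JumpBoxLRO : Prop :=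
  0 < Literature.Probability.Percolation.theta (Literature.Probability.LatticeModels.zdGraph 3) 0 (Literature.Probability.Percolation.criticalProbI 3) → ∃ c : ℝ, 0 < c ∧ ∀ᶠ n : ℕ in Filter.atTop, ∀ y ∈ Literature.Probability.LatticeModels.box 3 n, c ≤ (Literature.Probability.Percolation.bondPercolation (Literature.Probability.LatticeModels.zdGraph 3) (Literature.Probability.Percolation.criticalProbI 3)).real (Literature.Probability.Percolation.openConnIn ↑(Literature.Probability.LatticeModels.box 3 ⌈(n : ℝ) ^ ((7 : ℝ) / 6)⌉₊) 0 y)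

/-- Restated support `RaceLemmaLRO` (replaces stmt-5788 `RaceLemma`; PROVED 1:1 by `Consumed.raceLemma_of_jumpBoxLRO`, p125450):
for real `a, b` with `0 ≤ b` and `(1+b)(3−a) < 3`, `S(a)` and the consumed form at exponent `b` give `θ(p_c) = 0`. -/
def RaceLemmaLRO : Prop :=
  ∀ a b : ℝ, 0 ≤ b → (1 + b) * (3 - a) < 3 → (∃ C : ℝ, ∀ R : ℕ, 1 ≤ R → ∑ y ∈ Literature.Probability.LatticeModels.box 3 R, (Literature.Probability.Percolation.bondPercolation (Literature.Probability.LatticeModels.zdGraph 3) (Literature.Probability.Percolation.criticalProbI 3)).real (Literature.Probability.Percolation.openConnIn ↑(Literature.Probability.LatticeModels.box 3 R) 0 y) ≤ C * (R : ℝ) ^ (3 - a)) → (0 < Literature.Probability.Percolation.theta (Literature.Probability.LatticeModels.zdGraph 3) 0 (Literature.Probability.Percolation.criticalProbI 3) → ∃ c : ℝ, 0 < c ∧ ∀ᶠ n : ℕ in Filter.atTop, ∀ y ∈ Literature.Probability.LatticeModels.box 3 n, c ≤ (Literature.Probability.Percolation.bondPercolation (Literature.Probability.LatticeModels.zdGraph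 3) (Literature.Probability.Percolation.criticalProbI 3)).real (Literature.Probability.Percolation.openConnIn ↑(Literature.Probability.LatticeModels.box 3 ⌈(n : ℝ) ^ (1 + b)⌉₊) 0 y)) → PercolationContinuityZ3

/-- The restated support is closed BY NAME by the landed theorem (so restating reopens nothing). [folklore] -/
theorem raceLemmaLRO_proof : RaceLemmaLRO :=
  Summit.CriticalPhenomena.PercolationContinuityZ3.Theorems.NearLinearTwoClusterDecay.Consumed.raceLemma_of_jumpBoxLRO

/-- The deciding theorem after Option B (for `--closes-file`; same shape and glue arithmetic as today's `closes`). [folklore] -/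
theorem closesB (hS : FreeSusceptibilityPowerSaving) (hU : JumpBoxLRO) (hR : RaceLemmaLRO) : PercolationContinuityZ3 := by
  have h := hR (1 / 2) (1 / 6) (by norm_num) (by norm_num)
  have e1 : (3 : ℝ) - 1 / 2 = 5 / 2 := by norm_num
  have e2 : (1 : ℝ) + 1 / 6 = 7 / 6 := by norm_num
  rw [e1, e2] at h
  exact h hS hU

/-- The restated crux is a WEAKENING of the filed one: `U(1/6) → JumpBoxLRO` (Harris–FKG + first exits, landed as
`Consumed.jumpBoxLRO_of_jumpTwoClusterDecay` at `b = 1/6`). [folklore] -/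
theorem jumpBoxLRO_of_crux (hU : NearLinearTwoClusterDecay) : JumpBoxLRO := by
  have h := Summit.CriticalPhenomena.PercolationContinuityZ3.Theorems.NearLinearTwoClusterDecay.Consumed.jumpBoxLRO_of_jumpTwoClusterDecay
    (1 / 6) (by norm_num)
  have e2 : (1 : ℝ) + 1 / 6 = 7 / 6 := by norm_num
  rw [e2] at h
  exact h (fun _ => hU)

/-- Option B's deciding theorem closes from today's items already: `S(1/2)` and the FILED `U` (sanity: the restated
route is not weaker than needed and not stronger than today's). [folklore] -/
theorem closesB_of_current (hS : FreeSusceptibilityPowerSaving) (hU : NearLinearTwoClusterDecay) : PercolationContinuityZ3 :=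
  closesB hS (jumpBoxLRO_of_crux hU) raceLemmaLRO_proof

end Summit.CriticalPhenomena.PercolationContinuityZ3.Cruxes.NearLinearTwoClusterDecay.RestateCheckC7
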